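import Summits.ResolutionOfSingularities.ResolutionOfSingularities.Theorems.StallVertexLockClasses
import Summits.ResolutionOfSingularities.ResolutionOfSingularities.Theorems.PlanarGhostDescent
import HarnessLib

/-!
# StallVertexCompanion — decomp-res node «StallVertexCompanion (lens-5 g29, rev 10 of the node «StallVertex»; critic
row 192 CLEARED +1)», tree file 1/8 of the node

Content from the decomp-res lens-5 g29 node file `HOME/decomp-res-lens-5/g29/StallVertexCompanion.lean` (pin sha256
deaa8fea, 1856 l; HOME = run/shared/lean/pub/decomp-res) with EXACTLY the ten MECHANICAL lint fixes ordered by the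
critic (CRITIC-LEDGER row 192 / INBOX 07:14:46Z; content unchanged): l.376 the no-op `push_cast` deleted; `omit
[DecidableEq K] in` added before `linear_ne_zero` and `low_layer_of_cone`, `[DecidableEq σ]` added to the `omit` of
`free_monomial`; the deprecated aliases `MvPolynomial.mem_vars` ↦ `MvPolynomial.mem_vars_iff_mem_support` (3×) and
`MvPolynomial.coeff_X'` ↦ `MvPolynomial.coeff_X`; the unused binders of `low_layer_of_staysOnNewest` renamed `hb'j'`
↦ `_hb'j'`, `hd'` ↦ `_hd'` — fixed file sha256 245dae5b, writer's farm re-check rc 0 · 0 err · 0 sorry · 42 warnings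
ALL dupNamespace (the library's option) · axioms std.  The node imports the LANDED tree only
(`Theorems.StallVertexLockClasses`, `Theorems.PlanarGhostDescent`) and carries nothing — every declaration is new,
namespace `…Theorems.StallVertex` (the node's existing namespace).  Landing order (critic rider):
`Theorems/StallVertexCompanion.lean --kind proof --supports stmt-ResolutionOfSingularities-31770` (pure addition;
the untagged `def … : Prop` declarations are THIS node's cells — kind advisory as for `StallVertexFlatClasses`); NO
aside switch (31770 `DefectWalksDeep` stays the lens-5 live aside: DefectWalksDeep = tangent-positive leaf
`StallVertex.NoTangentPositiveSkewStalledTailsDeep` [lens-5, EXPECTED-EMPTY] ∧ null-flat leaf [orphaned; open IFP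
dim-4 monomial case], `defectWalksDeep_iff_tangentPositive_nullFlat`).

(The lens header is reproduced verbatim in part 2, `StallVertexCompanion2` — this first part is one long declaration
with no room left under the 400-line cap.)

## This file

§1k `stall_ledger` — the `μ̃`-stall ledger completed for a GENERAL cone (`section Vertex`): kept young letters keep
their divisor mass exactly, lost young letters are non-deficient, the move attains the universal bound — continued
in `StallVertexCompanion2`… (§1l the companion cone algebra `attained_factor` / `cone_of_low_layer` /
`low_layer_of_cone` / `low_layer_of_staysOnNewest`, §2e THE FLAT LAW `flat_law` / `companion_level`, §2f THE TANGENT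
LAW `tangentAt_of_tangentAt_succ` / `tangentAt_of_staysOnNewest` / `tangent_law`, §4m/§3c the cells `NoDeficient…` /
`NoSecant…` EMPTY, located residual `NoTangentPositiveSkewStalledTailsDeep`,
`defectWalksDeep_iff_tangentPositive_nullFlat`, `closes_tangentPositive_nullFlat`) where the 400-line cap cuts.
(This first part carries `section Vertex`: `stall_ledger`.)

[WRITER NOTE (decomp-res writer g12): file split only (tree files ≤ 400 lines) plus the ten critic-ordered lint
fixes listed in `StallVertexCompanion`; namespace, sections, section variables / opens / `set_option maxHeartbeats …
in` lines and every declaration otherwise exactly as in the lens.]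

(Sources: KawanoueMatsuki2012 arXiv:1205.4556 Prop. 3 (the companion (c_{f,𝕆}·𝕄^{-a}, μ̃·a)); Moh1987; Hauser2010
(kangaroo points); HauserPerlega2019 §2; HauserPerlega2024; CossartPiltant2008 §2; CossartJannsenSaito2020 Ch. 8;
Benito–Villamayor (monomial case); Hironaka2005.)
-/

noncomputable section

open MvPolynomial Finset
open Literature.AlgebraicGeometry.Resolution
open Literature.AlgebraicGeometry.Resolution.Hauser2010
open Literature.AlgebraicGeometry.Resolution.HauserPerlega2024
open Literature.Barriers.ResolutionOfSingularities
open Literature.AlgebraicGeometry.Resolution.PointBlowup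
open Summit.ResolutionOfSingularities.ResolutionOfSingularities.Theses
open Summit.ResolutionOfSingularities.ResolutionOfSingularities.Theorems.TightDefectClasses
open Summit.ResolutionOfSingularities.ResolutionOfSingularities.Theorems.ProximityCut
open Summit.ResolutionOfSingularities.ResolutionOfSingularities.Theorems.ExitLaw
open Summit.ResolutionOfSingularities.ResolutionOfSingularities.Theorems.DifferentialShade

namespace Summit.ResolutionOfSingularities.ResolutionOfSingularities.Theorems.StallVertex

section Vertex

variable {σ : Type*} {K : Type*} [Field K] [Fintype σ] [DecidableEq σ] [DecidableEq K]

/-! ### §1k (rev 10, generation 29) THE STALL LEDGER COMPLETED: kept masses are constant, lost letters are non-deficient -/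

set_option maxHeartbeats 1600000 in

/-- **THE STALL LEDGER (general cone).**  At a `μ̃`-stalled move `(j, b)` (`b_j = 0`) of a corner state at a point of
`Sing`, for a `μ_P`-minimiser `J₀` of level `a₀ = q − |J₀|`:
(6) every KEPT young letter `i` (`i ≠ j`, `b_i = 0`) has `μ_{P',D_i} = μ_{P,D_i}` EXACTLY (the mass can only grow,
`divisorOrder_le_divisorOrder_kept`, and the closed Kawanoue–Matsuki chain leaves no room for growth);
(7) every LOST young letter `i` (`i = j ∨ b_i ≠ 0`) is NON-DEFICIENT for `g_{J₀}`:
`μ_{P,D_i} = levelRatio (ord_{u_i} g_{J₀}) a₀`, i.e. `a₀ μ_{P,D_i} = ord_{u_i} g_{J₀} ∈ ℕ` (the universal upper bound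
`ordZero_dirForm_add_le` is attained, `stall_rigid` (1), and `a₀ μ_{P,D_i} ≤ ord_{u_i} g_{J₀}` termwise).
(8) the universal bound is ATTAINED: `ord₀ dirForm + |sx| + kx = d₀` with `sx = Σ_{young, bᵢ ≠ 0} ord_{u_i} g_{J₀}·1_i`,
`kx = ord_{u_j} g_{J₀}·[j young]` (the input of the equality case `attained_factor`).
This is `lost_nondeficient` / `kept_nondeficient` of rev 7 WITHOUT the monomial-cone hypothesis.
(Sources: KawanoueMatsuki2016, Proposition 4 (2), §4.1; arXiv:1205.4556 Proposition 3; new.) -/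
theorem stall_ledger (q : ℕ) (j : σ) (b : σ → K) (hbj : b j = 0) (t : IFPState σ K)
    (hlev : ∀ J ∈ t.idx, J.degree < q)
    (hsing : ∀ J ∈ t.idx, t.gen J ≠ 0 → (((q - J.degree : ℕ) : ℕ∞)) ≤ ordZero (t.gen J))
    (hstall : t.muTilde q ≤ (t.step q j b).muTilde q)
    {J₀ : σ →₀ ℕ} (hJ₀ : J₀ ∈ t.idx) (hμ : t.muP q = levelRatio (ordZero (t.gen J₀)) (q - J₀.degree))
    {d₀ : ℕ} (hd₀ : ordZero (t.gen J₀) = d₀) :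
    (∀ i ∈ t.young, i ≠ j → b i = 0 → (t.step q j b).muPD q i = t.muPD q i) ∧
    (∀ i ∈ t.young, (i = j ∨ b i ≠ 0) →
      t.muPD q i = levelRatio (divisorOrder i (t.gen J₀)) (q - J₀.degree)) ∧
    (ordZero (dirForm d₀ j b (t.gen J₀))).toNat +
      ((∑ i ∈ t.young.filter (fun i => b i ≠ 0), Finsupp.single i (divisorOrder i (t.gen J₀)).toNat).degree +
        (if j ∈ t.young then (divisorOrder j (t.gen J₀)).toNat else 0)) = d₀ := by
  classical
  have hstall' := hstall
  set g₀ := t.gen J₀ with hg₀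
  set a₀ : ℕ := q - J₀.degree with ha₀
  have hg₀ne : g₀ ≠ 0 := by
    intro h0
    rw [h0, ordZero_zero] at hd₀
    exact ENat.top_ne_coe _ hd₀
  have htop : t.muP q ≠ ⊤ := by
    rw [hμ, hd₀, levelRatio_natCast]; exact WithTop.coe_ne_top
  have ha₀pos : 0 < a₀ := by have := hlev J₀ hJ₀; omega
  have had₀ : a₀ ≤ d₀ := by
    have := hsing J₀ hJ₀ hg₀ne
    rw [← hg₀, hd₀] at this
    exact_mod_cast this
  have ha₀q : (0 : ℚ) < a₀ := by exact_mod_cast ha₀pos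
  -- μ_P = d₀ / a₀
  have hμval : t.muP q = (((d₀ : ℚ) / a₀ : ℚ) : WithTop ℚ) := by
    rw [hμ, hd₀]; rfl
  set m : ℚ := (d₀ : ℚ) / a₀ with hm
  have hma : m * a₀ = d₀ := by rw [hm]; exact div_mul_cancel₀ _ ha₀q.ne'
  have hratio : ∀ J ∈ t.idx, (m : WithTop ℚ) ≤ levelRatio (ordZero (t.gen J)) (q - J.degree) := by
    intro J hJ
    rw [← hμval]
    exact Finset.inf_le hJ
  -- the transported state
  set t' := t.step q j b with ht'
  have hgen' : ∀ J, t'.gen J = PointBlowup.translate b (chartTransform (q - J.degree) j (t.gen J)) := fun J => rfl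
  have hidx' : t'.idx = t.idx := rfl
  have hyoung' : t'.young = insert j (t.young.filter fun i => b i = 0) := rfl
  set Kept : Finset σ := (t.young.erase j).filter fun i => b i = 0 with hKept
  set ε : σ → ℕ := fun i => (divisorOrder i g₀).toNat with hε
  -- (1') THE LAYER BOUND in place of the Moh monomial: μ_P' ≤ ((d₀ - a₀) + n) / a₀, n = ord (dirForm)
  set T := dirForm d₀ j b g₀ with hTdef
  have hTne : T ≠ 0 := dirForm_ne_zero j b hd₀
  set n : ℕ := (ordZero T).toNat with hn
  have hTn : ordZero T = n := (coe_toNat_ordZero hTne).symm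
  have hg₀' : t'.gen J₀ = PointBlowup.translate b (chartTransform a₀ j g₀) := hgen' J₀
  have hA : ordZero (t'.gen J₀) ≤ ((d₀ - a₀ + n : ℕ) : ℕ∞) := by
    rw [hg₀', Nat.cast_add, ← hTn]
    exact ordZero_move_le_layer b hbj had₀ hd₀
  have hg₀'ne : t'.gen J₀ ≠ 0 := by
    intro h0
    rw [h0, ordZero_zero, top_le_iff] at hA
    exact ENat.coe_ne_top _ hA
  set M : ℚ := ((d₀ : ℚ) - a₀ + n) / a₀ with hM
  have hMa : M * a₀ = (d₀ : ℚ) - a₀ + n := by rw [hM]; exact div_mul_cancel₀ _ ha₀q.ne'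
  have hμ'le : t'.muP q ≤ ((M : ℚ) : WithTop ℚ) := by
    calc t'.muP q ≤ levelRatio (ordZero (t'.gen J₀)) (q - J₀.degree) := Finset.inf_le (hidx' ▸ hJ₀)
      _ ≤ levelRatio ((d₀ - a₀ + n : ℕ) : ℕ∞) a₀ := levelRatio_mono hA a₀
      _ = ((((d₀ - a₀ + n : ℕ) : ℚ) / a₀ : ℚ) : WithTop ℚ) := levelRatio_natCast _ _
      _ = ((M : ℚ) : WithTop ℚ) := by rw [hM, Nat.cast_add, Nat.cast_sub had₀]
  have hμ'ne : t'.muP q ≠ ⊤ := ne_top_of_le_ne_top WithTop.coe_ne_top hμ'le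
  obtain ⟨m', hm'⟩ := WithTop.ne_top_iff_exists.mp hμ'ne
  have hm'le : m' ≤ M := by
    have := hμ'le; rw [← hm'] at this; exact WithTop.coe_le_coe.mp this
  -- (2) μ_{P',D_j} ≥ m − 1 (as in Prop. 4 (2))
  have hnew : ((m - 1 : ℚ) : WithTop ℚ) ≤ t'.muPD q j := by
    refine Finset.le_inf fun J hJ => ?_
    rw [hidx'] at hJ
    rw [hgen']
    by_cases hJ0 : t.gen J = 0
    · rw [hJ0, chartTransform_zero]
      unfold PointBlowup.translate PointBlowup.divisorOrder
      rw [map_zero, MvPolynomial.support_zero, Finset.inf_empty, levelRatio_top]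
      exact le_top
    obtain ⟨dJ, hdJ⟩ := exists_ordZero_eq_natCast hJ0
    have haJ : q - J.degree ≤ dJ := by
      have := hsing J hJ hJ0; rw [hdJ] at this; exact_mod_cast this
    have haJpos : (0 : ℚ) < (q - J.degree : ℕ) := by
      have := hlev J hJ; exact_mod_cast (by omega : 0 < q - J.degree)
    have h1 := le_divisorOrder_new b hbj (q - J.degree) (t.gen J)
    rw [hdJ, ENat.toNat_coe] at h1
    calc ((m - 1 : ℚ) : WithTop ℚ) ≤ ((((dJ - (q - J.degree) : ℕ) : ℚ) / (q - J.degree : ℕ) : ℚ) : WithTop ℚ) := by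
          rw [WithTop.coe_le_coe]
          have hr := hratio J hJ
          rw [hdJ, levelRatio_natCast, WithTop.coe_le_coe] at hr
          rw [Nat.cast_sub haJ, sub_div, div_self (ne_of_gt haJpos)]
          linarith
      _ = levelRatio ((dJ - (q - J.degree) : ℕ) : ℕ∞) (q - J.degree) := (levelRatio_natCast _ _).symm
      _ ≤ levelRatio (divisorOrder j (PointBlowup.translate b (chartTransform (q - J.degree) j (t.gen J)))) (q - J.degree) :=
          levelRatio_mono h1 _
  -- (3) kept components: μ_{P',D_i} ≥ μ_{P,D_i}
  have hkept : ∀ i ∈ Kept, t.muPD q i ≤ t'.muPD q i := by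
    intro i hi
    have hij : i ≠ j := Finset.ne_of_mem_erase (Finset.mem_filter.mp hi).1
    have hbi : b i = 0 := (Finset.mem_filter.mp hi).2
    refine Finset.le_inf fun J hJ => ?_
    rw [hidx'] at hJ
    rw [hgen']
    calc t.muPD q i ≤ levelRatio (divisorOrder i (t.gen J)) (q - J.degree) := Finset.inf_le hJ
      _ ≤ _ := levelRatio_mono (divisorOrder_le_divisorOrder_kept b hij hbi _ _) _
  -- finiteness
  have hPDfin : ∀ i, t.muPD q i ≤ (((ε i : ℚ) / a₀ : ℚ) : WithTop ℚ) := by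
    intro i
    calc t.muPD q i ≤ levelRatio (divisorOrder i g₀) (q - J₀.degree) := Finset.inf_le hJ₀
      _ = _ := by rw [← ENat.coe_toNat (divisorOrder_ne_top (i := i) hg₀ne)]; exact levelRatio_natCast _ _
  have hPD'fin : ∀ i, t'.muPD q i ≠ ⊤ := by
    intro i
    have h1 : t'.muPD q i ≤ levelRatio (divisorOrder i (t'.gen J₀)) (q - J₀.degree) := Finset.inf_le (hidx' ▸ hJ₀)
    rw [← ENat.coe_toNat (divisorOrder_ne_top (i := i) hg₀'ne), levelRatio_natCast] at h1
    exact ne_top_of_le_ne_top WithTop.coe_ne_top h1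
  -- the numbers
  set u : σ → ℚ := fun i => (t.muPD q i).untopD 0 with hu
  set u' : σ → ℚ := fun i => (t'.muPD q i).untopD 0 with hu'
  have hu'j : m - 1 ≤ u' j := le_untopD_of_coe_le hnew (hPD'fin j)
  have hu'kept : ∀ i ∈ Kept, u i ≤ u' i := fun i hi => untopD_le_untopD (hkept i hi) (hPD'fin i)
  -- unfold the two μ̃'s in the stall hypothesis
  have hμt : t.muTilde q = ((m - ∑ i ∈ t.young, u i : ℚ) : WithTop ℚ) := by
    unfold IFPState.muTilde; rw [hμval]; rfl
  have hμt' : t'.muTilde q = ((m' - ∑ i ∈ t'.young, u' i : ℚ) : WithTop ℚ) := by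
    unfold IFPState.muTilde; rw [← hm']; rfl
  rw [hμt, hμt', WithTop.coe_le_coe] at hstall
  -- sums over young' and young
  have hsum' : u' j + ∑ i ∈ Kept, u' i ≤ ∑ i ∈ t'.young, u' i := by
    have hj : j ∈ t'.young := IFPState.mem_young_step q j b t
    rw [← Finset.add_sum_erase _ _ hj, hyoung', Finset.erase_insert_eq_erase, hKept]
    have : (t.young.erase j).filter (fun i => b i = 0) = (t.young.filter fun i => b i = 0).erase j := by
      ext i; simp [Finset.mem_filter, Finset.mem_erase, and_assoc]
    rw [this]
  have hKeptEq : Kept = t.young.filter fun i => ¬ (i = j ∨ b i ≠ 0) := by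
    ext i
    simp only [hKept, Finset.mem_filter, Finset.mem_erase, not_or, not_not]
    tauto
  have hsplit : ∑ i ∈ t.young, u i = lostMass q j b t + ∑ i ∈ Kept, u i := by
    rw [hKeptEq, lostMass]
    exact (Finset.sum_filter_add_sum_filter_not t.young (fun i => i = j ∨ b i ≠ 0) u).symm
  have hKsum : ∑ i ∈ Kept, u i ≤ ∑ i ∈ Kept, u' i := Finset.sum_le_sum fun i hi => hu'kept i hi
  -- (UB) THE UNIVERSAL UPPER BOUND `n + a₀·lostMass ≤ d₀` (`ordZero_dirForm_add_le` with the divisor orders of `g₀`)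
  set S : Finset σ := t.young.filter fun i => b i ≠ 0 with hS
  have hjS : j ∉ S := by
    rw [hS, Finset.mem_filter, not_and, not_not]; exact fun _ => hbj
  set sx : σ →₀ ℕ := ∑ i ∈ S, Finsupp.single i (ε i) with hsx
  have hsx_apply : ∀ i, sx i = if i ∈ S then ε i else 0 := by
    intro i
    rw [hsx, Finsupp.coe_finsetSum, Finset.sum_apply]
    simp_rw [Finsupp.single_apply]
    exact Finset.sum_ite_eq' S i ε
  have hsx_deg : sx.degree = ∑ i ∈ S, ε i := by
    rw [hsx, map_sum]
    exact Finset.sum_congr rfl fun i _ => Finsupp.degree_single _ _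
  set kx : ℕ := if j ∈ t.young then ε j else 0 with hkx
  have hεle : ∀ e ∈ g₀.support, ∀ i, ε i ≤ e i := fun e he i => by
    have h := divisorOrder_le_exponent (i := i) he
    rw [← ENat.coe_toNat (divisorOrder_ne_top (i := i) hg₀ne)] at h
    exact_mod_cast h
  have hGx : ∀ e ∈ g₀.support, sx ≤ e ∧ kx ≤ e j := by
    intro e he
    refine ⟨fun i => ?_, ?_⟩
    · rw [hsx_apply]
      split_ifs
      · exact hεle e he i
      · exact Nat.zero_le _
    · rw [hkx]
      split_ifs
      · exact hεle e he j
      · exact Nat.zero_le _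
  have hsxj : sx j = 0 := by rw [hsx_apply, if_neg hjS]
  have hsxb : ∀ i, sx i ≠ 0 → b i ≠ 0 := by
    intro i hi
    rw [hsx_apply] at hi
    split_ifs at hi with h
    · exact (Finset.mem_filter.mp h).2
    · exact absurd rfl hi
  have hUB := ordZero_dirForm_add_le j b hd₀ sx hsxj hsxb kx hGx
  rw [hTn, ← Nat.cast_add, Nat.cast_le] at hUB
  -- `a₀ · lostMass ≤ kx + |sx|`
  have hui : ∀ i, (a₀ : ℚ) * u i ≤ ε i := fun i => by
    have h := untopD_le_of_le_coe (hPDfin i)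
    rw [mul_comm]
    exact (le_div_iff₀ ha₀q).mp h
  have hF : t.young.filter (fun i => i = j ∨ b i ≠ 0) = t.young.filter (fun i => i = j) ∪ S := by
    rw [hS]; exact Finset.filter_or _ _ t.young
  have hdisj : Disjoint (t.young.filter (fun i => i = j)) S := by
    rw [Finset.disjoint_left]
    intro i hi hiS
    rw [Finset.mem_filter] at hi
    rw [hi.2] at hiS
    exact hjS hiS
  have hL : (a₀ : ℚ) * lostMass q j b t ≤ (kx : ℚ) + sx.degree := by
    rw [lostMass, Finset.mul_sum, hF, Finset.sum_union hdisj, hsx_deg, hkx, Finset.filter_eq' t.young j]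
    push_cast
    have h2 : ∑ i ∈ S, (a₀ : ℚ) * u i ≤ ∑ i ∈ S, (ε i : ℚ) := Finset.sum_le_sum fun i _ => hui i
    have h1 : ∑ i ∈ (if j ∈ t.young then ({j} : Finset σ) else ∅), (a₀ : ℚ) * u i ≤
        (if j ∈ t.young then ((ε j : ℕ) : ℚ) else 0) := by
      split_ifs
      · rw [Finset.sum_singleton]; exact hui j
      · rw [Finset.sum_empty]
    exact add_le_add h1 h2
  have hUBq : (n : ℚ) + (a₀ : ℚ) * lostMass q j b t ≤ d₀ := by
    have h : ((n + (sx.degree + kx) : ℕ) : ℚ) ≤ d₀ := by exact_mod_cast hUB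
    push_cast at h
    linarith [hL]
  -- the K–M chain is now a chain of EQUALITIES
  have hm'ge : 2 * m - 1 - lostMass q j b t ≤ m' := by
    linarith [hstall, hsum', hKsum, hu'j, hsplit]
  have hX : (2 * m - 1 - lostMass q j b t) * a₀ = 2 * d₀ - a₀ - a₀ * lostMass q j b t := by
    rw [← hma]; ring
  have hMle : M ≤ 2 * m - 1 - lostMass q j b t := by
    refine le_of_mul_le_mul_right ?_ ha₀q
    rw [hMa, hX]
    linarith [hUBq]
  have hm'eq : m' = M := le_antisymm hm'le (hMle.trans hm'ge)
  have hMeq : M = 2 * m - 1 - lostMass q j b t := le_antisymm hMle (hm'ge.trans hm'le)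
  have hlaw := stall_vertex q j b hbj t hlev hsing hstall' hJ₀ hμ hd₀
  -- the order of the transported minimiser
  obtain ⟨d', hd'⟩ := exists_ordZero_eq_natCast hg₀'ne
  have hlow : (((d₀ : ℚ) - a₀ + n : ℚ)) ≤ (d' : ℚ) := by
    have h1 : t'.muP q ≤ levelRatio (ordZero (t'.gen J₀)) (q - J₀.degree) := Finset.inf_le (hidx' ▸ hJ₀)
    rw [hd', levelRatio_natCast, ← hm', WithTop.coe_le_coe, hm'eq] at h1
    exact (div_le_div_iff_of_pos_right ha₀q).mp (show M ≤ (d' : ℚ) / a₀ from h1)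
  have hA' : d' ≤ d₀ - a₀ + n := by
    have h := hA; rw [hd'] at h; exact_mod_cast h
  have hd'eq : d' = d₀ - a₀ + n := by
    apply le_antisymm hA'
    have h : ((d₀ - a₀ + n : ℕ) : ℚ) ≤ d' := by push_cast [Nat.cast_sub had₀]; linarith [hlow]
    exact_mod_cast h
  have h1 : (n : ℚ) = (d₀ : ℚ) - a₀ * lostMass q j b t := by linarith [hlaw, hUBq]
  -- (6) the kept masses: the chain is tight, so `Σ_Kept u' = Σ_Kept u`, termwise
  have hKsum' : ∑ i ∈ Kept, u' i ≤ ∑ i ∈ Kept, u i := by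
    linarith [hstall, hsum', hu'j, hsplit, hm'eq, hMeq]
  have hKeq : ∀ i ∈ Kept, u i = u' i :=
    (Finset.sum_eq_sum_iff_of_le fun i hi => hu'kept i hi).mp (le_antisymm hKsum hKsum')
  have hPDfin' : ∀ i, t.muPD q i ≠ ⊤ := fun i => ne_top_of_le_ne_top WithTop.coe_ne_top (hPDfin i)
  -- (7) the lost letters: `kx + |sx| = a₀·lostMass`, termwise
  have hUB' : ((sx.degree : ℕ) : ℚ) + kx ≤ a₀ * lostMass q j b t := by
    have h : ((n + (sx.degree + kx) : ℕ) : ℚ) ≤ d₀ := by exact_mod_cast hUB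
    push_cast at h
    linarith [h1]
  have hdecomp : (a₀ : ℚ) * lostMass q j b t =
      (∑ i ∈ (if j ∈ t.young then ({j} : Finset σ) else ∅), (a₀ : ℚ) * u i) + ∑ i ∈ S, (a₀ : ℚ) * u i := by
    rw [lostMass, Finset.mul_sum, hF, Finset.sum_union hdisj, Finset.filter_eq' t.young j]
  have hjpart : ∑ i ∈ (if j ∈ t.young then ({j} : Finset σ) else ∅), (a₀ : ℚ) * u i ≤
      (if j ∈ t.young then ((ε j : ℕ) : ℚ) else 0) := by
    split_ifs
    · rw [Finset.sum_singleton]; exact hui j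
    · rw [Finset.sum_empty]
  have hSpart : ∑ i ∈ S, (a₀ : ℚ) * u i ≤ ∑ i ∈ S, (ε i : ℚ) := Finset.sum_le_sum fun i _ => hui i
  have hkxq : (kx : ℚ) = (if j ∈ t.young then ((ε j : ℕ) : ℚ) else 0) := by
    rw [hkx]; split_ifs <;> simp
  have hsxq : ((sx.degree : ℕ) : ℚ) = ∑ i ∈ S, (ε i : ℚ) := by rw [hsx_deg]; push_cast; rfl
  have hSeq : ∑ i ∈ S, (a₀ : ℚ) * u i = ∑ i ∈ S, (ε i : ℚ) := by
    linarith [hdecomp, hjpart, hSpart, hUB', hkxq, hsxq]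
  have hjeq : ∑ i ∈ (if j ∈ t.young then ({j} : Finset σ) else ∅), (a₀ : ℚ) * u i =
      (if j ∈ t.young then ((ε j : ℕ) : ℚ) else 0) := by
    linarith [hdecomp, hjpart, hSpart, hUB', hkxq, hsxq]
  have hSterm : ∀ i ∈ S, (a₀ : ℚ) * u i = ε i :=
    (Finset.sum_eq_sum_iff_of_le fun i _ => hui i).mp hSeq
  have hjterm : j ∈ t.young → (a₀ : ℚ) * u j = ε j := by
    intro hjy
    rw [if_pos hjy, if_pos hjy, Finset.sum_singleton] at hjeq
    exact hjeq
  -- conversion of the numbers back to `WithTop ℚ`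
  have hval : ∀ i, t.muPD q i = ((u i : ℚ) : WithTop ℚ) := by
    intro i
    obtain ⟨y, hy⟩ := WithTop.ne_top_iff_exists.mp (hPDfin' i)
    have : u i = y := by show (t.muPD q i).untopD 0 = y; rw [← hy]; rfl
    rw [this, hy]
  have hval' : ∀ i, t'.muPD q i = ((u' i : ℚ) : WithTop ℚ) := by
    intro i
    obtain ⟨y, hy⟩ := WithTop.ne_top_iff_exists.mp (hPD'fin i)
    have : u' i = y := by show (t'.muPD q i).untopD 0 = y; rw [← hy]; rfl
    rw [this, hy]
  have hlost : ∀ i ∈ t.young, (i = j ∨ b i ≠ 0) → (a₀ : ℚ) * u i = ε i := by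
    intro i hi hl
    rcases hl with rfl | hb
    · exact hjterm hi
    · exact hSterm i (by rw [hS, Finset.mem_filter]; exact ⟨hi, hb⟩)
  refine ⟨fun i hi hij hbi => ?_, fun i hi hl => ?_, ?_⟩
  · have hiK : i ∈ Kept := by
      rw [hKept, Finset.mem_filter, Finset.mem_erase]; exact ⟨⟨hij, hi⟩, hbi⟩
    rw [hval' i, hval i, ← hKeq i hiK]
  · rw [hval i, ← ENat.coe_toNat (divisorOrder_ne_top (i := i) hg₀ne), levelRatio_natCast, WithTop.coe_eq_coe]
    have h := hlost i hi hl
    rw [eq_div_iff ha₀q.ne', mul_comm]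
    exact h
  · -- (8) THE BOUND IS ATTAINED: `n + |sx| + kx = d₀`
    have h3 : (d₀ : ℚ) ≤ n + (sx.degree + kx) := by linarith [h1, hL]
    have h4 : d₀ ≤ n + (sx.degree + kx) := by exact_mod_cast h3
    show n + (sx.degree + kx) = d₀
    omega

end Vertex

end Summit.ResolutionOfSingularities.ResolutionOfSingularities.Theorems.StallVertex
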